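import Literature.Computability.Cryptography.KitaevPhaseEstimationCircuit
import Literature.Computability.Cryptography.ShorOrderFindingAnalysis
import HarnessLib

/-!
# Boneh–Lipton period finding read out by Kitaev's Hadamard tests, I: the Fourier identity

Topic `Literature/Computability/QuantumComplexity`; first of the analysis files behind the
discharge of `Literature.Barriers.QuantumAdvantage.aaronsonChen2017_lem75_quantum` (Aaronson–Chen
2017, Lemma 7.5 (2)–(3), App. 13: "we can apply Boneh and Lipton's quantum period-finding
algorithm to recover `a`"), where the period-finding experiment must be an EXACT Clifford+T
circuit with oracle gates. As for Shor's theorem in the tree (`Cryptography/KitaevPhaseEstimation*`,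
`ShorOrderFindingQuantum.lean`), the Fourier transform over `ℤ/2^b` is replaced by Kitaev's
Hadamard tests (Kitaev 1995, §3) of the controlled shifts of an offset register: offsets
`x ∈ {0,1}^b` and controls `y` in uniform superposition, a classical block writing
`G((x + A(y)) mod 2^b)` (`A(y) = ∑_j y_j 2^{e_j}`, `G` the oracle table), Hadamard read-out.
The tree's `kitaevCircuit_distribution` needs the fibres of the block to be residue classes of
the exponent (exact periodicity); a period `a ∤ 2^b` has no such structure, and this file proves
the replacement — an exact finite Fourier identity:

* characters `ch N m = e^{2πi m/N}`, orthogonality `sum_ch_mul`, Parseval on `ℤ/N`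
  (`parseval_range`) and on the cube (`sum_ySign_mul_ySign`, `cube_plancherel`);
* the fibre sum `fiberSum N G u = ∑_ω |∑_{z<N, G z = ω} e^{2πi uz/N}|²`, its total mass
  `sum_fiberSum` (`= N²`), its value `N` for injective `G` (`fiberSum_of_injOn`: a basis state has
  a flat spectrum) and `N² ∑_{k<a} P(u,k)` for `G = f ∘ (· mod a)` (`fiberSum_comp_mod`, `P` Shor's
  `Shor1997.outcomeProb`, by `Shor1997.norm_sq_amplitude_eq_outcomeProb`);
* **`sum_offset_fiber_norm_sq`** — summing over the offset decouples the frequencies: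
  `∑_{t<N} ∑_ω |∑_{y : G((t+A_y) mod N) = ω} φ_y|² = N⁻¹ ∑_u |∑_y φ_y e^{2πi uA_y/N}|² S_G(u)`;
* the factorised control sum `testProd` (`sum_prod_mul_ch_expo`) and its squared modulus as the
  product of Kitaev's single-test probabilities `testWeight` (`norm_sq_testProd_signChar`);
* **`readout_identity`** — offsets read out too (Plancherel on the cube): the squared fibre
  amplitudes summed over the offset read-out and the work content are the MIXTURE over `u < 2^b`,
  weights `S_G(u)`, of `|Φ(u)|²` — Shor's distribution for a periodic table, the uniform one for a
  permutation.

## References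

* A. Yu. Kitaev, *Quantum measurements and the Abelian Stabilizer Problem*, arXiv:quant-ph/9511026
  (1995), §3 (Remark 8, Lemma 8, Lemma 10), §4 [Kitaev1995].
* P. W. Shor, SIAM J. Comput. 26 (1997) 1484–1509, §5 (the distribution `P(c, k)`) [Shor1997].
* D. Boneh, R. J. Lipton, *Quantum cryptanalysis of hidden linear functions*, CRYPTO '95, LNCS 963,
  424–437 (period finding on `ℤ`) [BonehLipton1995].
* S. Aaronson, L. Chen, CCC 2017, arXiv:1612.05903, Lemma 7.5 and App. 13 (p. 42) [AaronsonChen2017].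
-/

noncomputable section

namespace Literature.Computability.QuantumComplexity

namespace PeriodFinding

open Complex Finset Real Literature.Computability.Cryptography
  Literature.Computability.Cryptography.Kitaev1995

/-! ### Characters of `ℤ/N` with integer numerators -/

/-- The character value `e^{2πi m/N}` of `ℤ/N` at the integer `m`. [folklore] -/
def ch (N : ℕ) (m : ℤ) : ℂ := cexp (2 * π * I * ((m : ℂ) / N))

variable {N : ℕ}

/-- `e^{2πi (m+m')/N} = e^{2πi m/N} e^{2πi m'/N}`. [folklore] -/
theorem ch_add (N : ℕ) (m m' : ℤ) : ch N (m + m') = ch N m * ch N m' := by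
  rw [ch, ch, ch, ← Complex.exp_add]
  congr 1
  push_cast
  ring

/-- `e^{2πi 0/N} = 1`. [folklore] -/
@[simp] theorem ch_zero (N : ℕ) : ch N 0 = 1 := by simp [ch]

/-- The conjugate character. [folklore] -/
theorem conj_ch (N : ℕ) (m : ℤ) : (starRingEnd ℂ) (ch N m) = ch N (-m) := by
  rw [ch, ch, ← Complex.exp_conj]
  congr 1
  simp only [map_mul, map_div₀, map_ofNat, Complex.conj_ofReal, Complex.conj_I, map_intCast,
    map_natCast]
  push_cast
  ring

/-- Characters are unimodular. [folklore] -/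
theorem norm_ch (N : ℕ) (m : ℤ) : ‖ch N m‖ = 1 := by
  rw [ch, show 2 * π * I * ((m : ℂ) / N) = ((2 * π * m / N : ℝ) : ℂ) * I by push_cast; ring]
  exact Complex.norm_exp_ofReal_mul_I _

/-- **Orthogonality**: `∑_{s<N} e^{2πi s m/N}` is `N` if `N ∣ m` and `0` otherwise. [folklore] -/
theorem sum_ch_mul (hN : 0 < N) (m : ℤ) :
    ∑ s ∈ range N, ch N (s * m) = if (N : ℤ) ∣ m then (N : ℂ) else 0 := by
  rw [← sum_range_exp_two_pi_mul N hN m]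
  refine sum_congr rfl fun s _ => ?_
  rw [ch]
  congr 2
  push_cast
  ring

/-- Two naturals below `N` are congruent modulo `N` iff they are equal. [folklore] -/
theorem dvd_sub_iff_eq {u u' : ℕ} (hu : u < N) (hu' : u' < N) :
    (N : ℤ) ∣ (u : ℤ) - u' ↔ u = u' := by
  rw [← Nat.modEq_iff_dvd]
  exact ⟨fun h => (Nat.ModEq.eq_of_lt_of_lt h hu' hu).symm, fun h => h ▸ Nat.ModEq.refl _⟩

/-- Orthogonality of two characters summed over `ℤ/N`. [folklore] -/
theorem sum_ch_mul_conj_ch (hN : 0 < N) {u u' : ℕ} (hu : u < N) (hu' : u' < N) :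
    ∑ t ∈ range N, ch N (u * t) * (starRingEnd ℂ) (ch N (u' * t)) =
      if u = u' then (N : ℂ) else 0 := by
  have h : ∀ t : ℕ, ch N (u * t) * (starRingEnd ℂ) (ch N (u' * t)) = ch N (t * ((u : ℤ) - u')) := by
    intro t
    rw [conj_ch, ← ch_add]
    congr 1
    ring
  simp_rw [h]
  rw [sum_ch_mul hN]
  exact if_congr (dvd_sub_iff_eq hu hu') rfl rfl

/-- **Parseval on `ℤ/N`**: `∑_{t<N} |∑_{u<N} a_u e^{2πi ut/N}|² = N ∑_{u<N} |a_u|²`. [folklore] -/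
theorem parseval_range (hN : 0 < N) (a : ℕ → ℂ) :
    ∑ t ∈ range N, ‖∑ u ∈ range N, a u * ch N (u * t)‖ ^ 2 =
      N * ∑ u ∈ range N, ‖a u‖ ^ 2 := by
  apply Complex.ofReal_injective
  rw [Complex.ofReal_sum, Complex.ofReal_mul, Complex.ofReal_sum]
  simp_rw [ofReal_norm_sq_sum, ofReal_norm_sq]
  calc ∑ t ∈ range N, ∑ u ∈ range N, ∑ u' ∈ range N,
        a u * ch N (u * t) * (starRingEnd ℂ) (a u' * ch N (u' * t))
      = ∑ u ∈ range N, ∑ u' ∈ range N, (a u * (starRingEnd ℂ) (a u')) *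
          ∑ t ∈ range N, ch N (u * t) * (starRingEnd ℂ) (ch N (u' * t)) := by
        rw [sum_comm]
        refine sum_congr rfl fun u _ => ?_
        rw [sum_comm]
        refine sum_congr rfl fun u' _ => ?_
        rw [mul_sum]
        refine sum_congr rfl fun t _ => ?_
        rw [map_mul]
        ring
    _ = ∑ u ∈ range N, a u * (starRingEnd ℂ) (a u) * N := by
        refine sum_congr rfl fun u hu => ?_
        rw [sum_eq_single_of_mem u hu]
        · rw [sum_ch_mul_conj_ch hN (mem_range.1 hu) (mem_range.1 hu), if_pos rfl]
        · intro u' hu' hne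
          rw [sum_ch_mul_conj_ch hN (mem_range.1 hu) (mem_range.1 hu'), if_neg (Ne.symm hne),
            mul_zero]
    _ = ((N : ℝ) : ℂ) * ∑ u ∈ range N, a u * (starRingEnd ℂ) (a u) := by
        rw [mul_sum]
        refine sum_congr rfl fun u _ => ?_
        push_cast
        ring

/-! ### The Boolean cube: orthogonality of the signs `(-1)^{x·γ}` and Plancherel -/

variable {b : ℕ}

/-- The signs `(-1)^{x·γ}` are real. [folklore] -/
theorem conj_ySign (x γ : Fin b → Bool) : (starRingEnd ℂ) (ySign x γ) = ySign x γ := by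
  rw [ySign, map_prod]
  refine prod_congr rfl fun j _ => ?_
  split_ifs <;> simp

/-- **Orthogonality on the cube**: `∑_γ (-1)^{x·γ} (-1)^{x'·γ} = 2^b [x = x']`. [folklore] -/
theorem sum_ySign_mul_ySign (x x' : Fin b → Bool) :
    ∑ γ : Fin b → Bool, ySign x γ * ySign x' γ = if x = x' then (2 : ℂ) ^ b else 0 := by
  have hterm : ∀ γ : Fin b → Bool, ySign x γ * ySign x' γ =
      ∏ j, ((if x j && γ j then (-1 : ℂ) else 1) * (if x' j && γ j then (-1 : ℂ) else 1)) := by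
    intro γ
    rw [ySign, ySign, ← prod_mul_distrib]
  simp_rw [hterm]
  rw [sum_pi_bool_prod fun j c =>
    (if x j && c then (-1 : ℂ) else 1) * (if x' j && c then (-1 : ℂ) else 1)]
  have hfac : ∀ j : Fin b, ((if x j && false then (-1 : ℂ) else 1) * (if x' j && false then (-1 : ℂ) else 1) +
      (if x j && true then (-1 : ℂ) else 1) * (if x' j && true then (-1 : ℂ) else 1)) =
      if x j = x' j then 2 else 0 := by
    intro j
    cases x j <;> cases x' j <;> norm_num
  simp_rw [hfac]
  split_ifs with hx
  · subst hx
    simp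
  · obtain ⟨j, hj⟩ : ∃ j, x j ≠ x' j := by
      by_contra h
      push Not at h
      exact hx (funext h)
    exact prod_eq_zero (mem_univ j) (if_neg hj)

/-- **Plancherel on the cube**: `∑_γ |∑_x (-1)^{x·γ} f(x)|² = 2^b ∑_x |f(x)|²`. [folklore] -/
theorem cube_plancherel (f : (Fin b → Bool) → ℂ) :
    ∑ γ : Fin b → Bool, ‖∑ x : Fin b → Bool, ySign x γ * f x‖ ^ 2 =
      2 ^ b * ∑ x : Fin b → Bool, ‖f x‖ ^ 2 := by
  apply Complex.ofReal_injective
  rw [Complex.ofReal_sum, Complex.ofReal_mul, Complex.ofReal_sum]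
  simp_rw [ofReal_norm_sq_sum, ofReal_norm_sq]
  calc ∑ γ : Fin b → Bool, ∑ x : Fin b → Bool, ∑ x' : Fin b → Bool,
        ySign x γ * f x * (starRingEnd ℂ) (ySign x' γ * f x')
      = ∑ x : Fin b → Bool, ∑ x' : Fin b → Bool, (f x * (starRingEnd ℂ) (f x')) *
          ∑ γ : Fin b → Bool, ySign x γ * ySign x' γ := by
        rw [sum_comm]
        refine sum_congr rfl fun x _ => ?_
        rw [sum_comm]
        refine sum_congr rfl fun x' _ => ?_
        rw [mul_sum]
        refine sum_congr rfl fun γ _ => ?_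
        rw [map_mul, conj_ySign]
        ring
    _ = ∑ x : Fin b → Bool, f x * (starRingEnd ℂ) (f x) * 2 ^ b := by
        refine sum_congr rfl fun x _ => ?_
        rw [Fintype.sum_eq_single x]
        · rw [sum_ySign_mul_ySign, if_pos rfl]
        · intro x' hne
          rw [sum_ySign_mul_ySign, if_neg (Ne.symm hne), mul_zero]
    _ = ((2 ^ b : ℝ) : ℂ) * ∑ x : Fin b → Bool, f x * (starRingEnd ℂ) (f x) := by
        rw [mul_sum]
        refine sum_congr rfl fun x _ => ?_
        push_cast
        ring


/-! ### Fibres of a function on `ℤ/N` shifted by an exponent: the correlation identity -/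

section Correlation

variable {Y Ω : Type*} [Fintype Y] [Fintype Ω] [DecidableEq Ω]

/-- **The fibre sum** `S_G(u) = ∑_ω |∑_{z<N, G z = ω} e^{2πi uz/N}|²`: the total Fourier weight
at frequency `u` of the (unnormalised) uniform superpositions over the fibres of `G` on
`[0, N)` — for `G` injective it is `N` at every `u`, for `G = f ∘ (· mod a)` it is `N²` times
Shor's outcome distribution (below). [cite: Shor1997, §5 (probability of observing |c, x^k mod n>)] -/
def fiberSum (N : ℕ) (G : ℕ → Ω) (u : ℕ) : ℝ :=
  ∑ ω, ‖∑ z ∈ (range N).filter (fun z => G z = ω), ch N (u * z)‖ ^ 2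

/-- Fibre sums are nonnegative. [folklore] -/
theorem fiberSum_nonneg (N : ℕ) (G : ℕ → Ω) (u : ℕ) : 0 ≤ fiberSum N G u :=
  sum_nonneg fun _ _ => by positivity

/-- The indicator of `m mod N = z` as a character sum (`z < N`). [folklore] -/
theorem indicator_eq_sum_ch (hN : 0 < N) (m : ℕ) {z : ℕ} (hz : z < N) :
    (if m % N = z then (1 : ℂ) else 0) = (1 / N : ℂ) * ∑ u ∈ range N, ch N (u * ((m : ℤ) - z)) := by
  rw [sum_ch_mul hN]
  have hN0 : (N : ℂ) ≠ 0 := by exact_mod_cast hN.ne'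
  have key : (N : ℤ) ∣ (m : ℤ) - z ↔ m % N = z := by
    rw [← Nat.modEq_iff_dvd, Nat.ModEq, Nat.mod_eq_of_lt hz]
    exact ⟨Eq.symm, Eq.symm⟩
  by_cases h : (N : ℤ) ∣ (m : ℤ) - z
  · rw [if_pos h, if_pos (key.1 h), one_div, inv_mul_cancel₀ hN0]
  · rw [if_neg h, if_neg (fun h' => h (key.2 h')), mul_zero]

omit [Fintype Ω] in
/-- The fibre indicator of the shifted argument as a character sum:
`[G((t + A_y) mod N) = ω] φ_y`, summed over `y`, is
`N⁻¹ ∑_{u<N} e^{2πi ut/N} · (∑_y φ_y e^{2πi u A_y/N}) · (∑_{z ∈ G⁻¹ω} e^{-2πi uz/N})`. [folklore] -/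
theorem sum_fiber_shift_eq (hN : 0 < N) (G : ℕ → Ω) (A : Y → ℕ) (φ : Y → ℂ) (t : ℕ) (ω : Ω) :
    ∑ y, (if G ((t + A y) % N) = ω then φ y else 0) =
      ∑ u ∈ range N, ((1 / N : ℂ) * ((∑ y, φ y * ch N (u * A y)) *
        ∑ z ∈ (range N).filter (fun z => G z = ω), ch N (-(u * z)))) * ch N (u * t) := by
  classical
  set F := (range N).filter (fun z => G z = ω) with hF
  -- the fibre indicator as a sum over the fibre
  have h1 : ∀ y, (if G ((t + A y) % N) = ω then φ y else 0) =
      φ y * ∑ z ∈ F, (if (t + A y) % N = z then (1 : ℂ) else 0) := by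
    intro y
    rw [Finset.sum_ite_eq]
    have hmem : (t + A y) % N ∈ range N := mem_range.2 (Nat.mod_lt _ hN)
    by_cases h : G ((t + A y) % N) = ω
    · have hF' : (t + A y) % N ∈ F := Finset.mem_filter.2 ⟨hmem, h⟩
      rw [if_pos h, if_pos hF', mul_one]
    · have hF' : (t + A y) % N ∉ F := fun h' => h (Finset.mem_filter.1 h').2
      rw [if_neg h, if_neg hF', mul_zero]
  have h2 : ∀ y, ∀ z ∈ F, (if (t + A y) % N = z then (1 : ℂ) else 0) =
      (1 / N : ℂ) * ∑ u ∈ range N, ch N (u * t) * ch N (u * A y) * ch N (-(u * z)) := by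
    intro y z hz
    have hzN : z < N := mem_range.1 (Finset.mem_filter.1 hz).1
    rw [indicator_eq_sum_ch hN (t + A y) hzN]
    congr 1
    refine sum_congr rfl fun u _ => ?_
    rw [← ch_add, ← ch_add]
    congr 1
    push_cast
    ring
  calc ∑ y, (if G ((t + A y) % N) = ω then φ y else 0)
      = ∑ y, φ y * ∑ z ∈ F, ((1 / N : ℂ) *
          ∑ u ∈ range N, (ch N (u * t) * ch N (u * A y) * ch N (-(u * z)))) := by
        refine sum_congr rfl fun y _ => ?_
        rw [h1 y]
        exact congrArg (φ y * ·) (sum_congr rfl fun z hz => h2 y z hz)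
    _ = ∑ y, ∑ z ∈ F, ∑ u ∈ range N,
          (1 / N : ℂ) * (φ y * ch N (u * A y)) * ch N (-(u * z)) * ch N (u * t) := by
        refine sum_congr rfl fun y _ => ?_
        rw [mul_sum]
        refine sum_congr rfl fun z _ => ?_
        rw [mul_sum, mul_sum]
        refine sum_congr rfl fun u _ => ?_
        ring
    _ = ∑ u ∈ range N, ∑ y, ∑ z ∈ F,
          (1 / N : ℂ) * (φ y * ch N (u * A y)) * ch N (-(u * z)) * ch N (u * t) :=
        (Finset.sum_congr rfl fun y _ => Finset.sum_comm).trans Finset.sum_comm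
    _ = ∑ u ∈ range N, ((1 / N : ℂ) * ((∑ y, φ y * ch N (u * A y)) *
          ∑ z ∈ F, ch N (-(u * z)))) * ch N (u * t) := by
        refine sum_congr rfl fun u _ => ?_
        rw [Finset.sum_mul_sum, mul_sum, sum_mul]
        refine sum_congr rfl fun y _ => ?_
        rw [mul_sum, sum_mul]
        refine sum_congr rfl fun z _ => ?_
        ring

/-- The conjugate of a fibre character sum. [folklore] -/
theorem norm_sum_ch_neg (N : ℕ) (F : Finset ℕ) (u : ℕ) :
    ‖∑ z ∈ F, ch N (-(u * z))‖ = ‖∑ z ∈ F, ch N (u * z)‖ := by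
  have h : ∑ z ∈ F, ch N (-(u * z)) = (starRingEnd ℂ) (∑ z ∈ F, ch N (u * z)) := by
    rw [map_sum]
    exact sum_congr rfl fun z _ => (conj_ch N _).symm
  rw [h, RCLike.norm_conj]

/-- **The correlation identity.** For a shift `A : Y → ℕ`, amplitudes `φ : Y → ℂ` and any
`G : ℕ → Ω`, summing over the offset `t ∈ ℤ/N` decouples the frequencies:
`∑_{t<N} ∑_ω |∑_{y : G((t+A_y) mod N) = ω} φ_y|² = N⁻¹ ∑_{u<N} |∑_y φ_y e^{2πi uA_y/N}|² S_G(u)`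
(Parseval on `ℤ/N` applied to `t`; the mechanism by which the uniformly superposed offset
register of the period-finding experiment turns the control read-out into a MIXTURE over the
Fourier label `u`). [folklore] -/
theorem sum_offset_fiber_norm_sq (hN : 0 < N) (G : ℕ → Ω) (A : Y → ℕ) (φ : Y → ℂ) :
    ∑ t ∈ range N, ∑ ω, ‖∑ y, (if G ((t + A y) % N) = ω then φ y else 0)‖ ^ 2 =
      (1 / N : ℝ) * ∑ u ∈ range N, ‖∑ y, φ y * ch N (u * A y)‖ ^ 2 * fiberSum N G u := by
  classical
  have hN0 : (N : ℝ) ≠ 0 := by exact_mod_cast hN.ne'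
  rw [sum_comm]
  simp_rw [sum_fiber_shift_eq hN G A φ]
  have hpar : ∀ ω : Ω, ∑ t ∈ range N, ‖∑ u ∈ range N, ((1 / N : ℂ) *
      ((∑ y, φ y * ch N (u * A y)) * ∑ z ∈ (range N).filter (fun z => G z = ω), ch N (-(u * z)))) *
        ch N (u * t)‖ ^ 2 =
      (1 / N : ℝ) * ∑ u ∈ range N, ‖∑ y, φ y * ch N (u * A y)‖ ^ 2 *
        ‖∑ z ∈ (range N).filter (fun z => G z = ω), ch N (u * z)‖ ^ 2 := by
    intro ω
    have h1 : ‖(1 / N : ℂ)‖ = 1 / N := by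
      rw [norm_div, norm_one, Complex.norm_natCast]
    rw [parseval_range hN, mul_sum, mul_sum]
    refine sum_congr rfl fun u _ => ?_
    rw [norm_mul, norm_mul, norm_sum_ch_neg, h1]
    field_simp
  simp_rw [hpar]
  rw [← mul_sum, sum_comm]
  congr 1
  refine sum_congr rfl fun u _ => ?_
  rw [fiberSum, mul_sum]

end Correlation


/-! ### Evaluations of the fibre sum -/

section FiberSum

variable {Ω : Type*} [Fintype Ω] [DecidableEq Ω]

/-- **Total mass** (Parseval): `∑_{u<N} S_G(u) = N²`. [folklore] -/
theorem sum_fiberSum (hN : 0 < N) (G : ℕ → Ω) : ∑ u ∈ range N, fiberSum N G u = (N : ℝ) ^ 2 := by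
  classical
  unfold fiberSum
  rw [sum_comm]
  apply Complex.ofReal_injective
  rw [Complex.ofReal_sum]
  simp_rw [Complex.ofReal_sum, ofReal_norm_sq_sum]
  have key : ∀ (F : Finset ℕ), F ⊆ range N →
      ∑ u ∈ range N, ∑ z ∈ F, ∑ z' ∈ F, ch N (u * z) * (starRingEnd ℂ) (ch N (u * z')) =
        N * F.card := by
    intro F hF
    calc ∑ u ∈ range N, ∑ z ∈ F, ∑ z' ∈ F, ch N (u * z) * (starRingEnd ℂ) (ch N (u * z'))
        = ∑ z ∈ F, ∑ z' ∈ F, ∑ u ∈ range N, ch N (z * u) * (starRingEnd ℂ) (ch N (z' * u)) := by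
          rw [sum_comm]
          refine sum_congr rfl fun z _ => ?_
          rw [sum_comm]
          refine sum_congr rfl fun z' _ => sum_congr rfl fun u _ => ?_
          rw [mul_comm (z : ℤ), mul_comm (z' : ℤ)]
      _ = ∑ z ∈ F, ∑ z' ∈ F, (if z = z' then (N : ℂ) else 0) := by
          refine sum_congr rfl fun z hz => sum_congr rfl fun z' hz' => ?_
          exact sum_ch_mul_conj_ch hN (mem_range.1 (hF hz)) (mem_range.1 (hF hz'))
      _ = N * F.card := by
          simp_rw [Finset.sum_ite_eq, ] 
          rw [Finset.sum_congr rfl fun z hz => if_pos hz, sum_const, nsmul_eq_mul, mul_comm]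
  rw [Finset.sum_congr rfl fun ω _ => key _ (Finset.filter_subset _ _), ← mul_sum]
  have hcard : ∑ ω : Ω, (((range N).filter (fun z => G z = ω)).card : ℂ) = N := by
    have h := Finset.card_eq_sum_card_fiberwise (s := range N) (t := (univ : Finset Ω))
      (f := G) (fun _ _ => mem_univ _)
    rw [card_range] at h
    exact_mod_cast h.symm
  rw [hcard]
  push_cast
  ring

/-- **Injective functions**: every frequency carries the same weight, `S_G(u) = N` (each fibre
is a single point, whose character sum has modulus `1`) — the Fourier sample of a basis state
is uniform. [folklore] -/
theorem fiberSum_of_injOn {G : ℕ → Ω} (hG : ∀ z ∈ range N, ∀ z' ∈ range N, G z = G z' → z = z')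
    (u : ℕ) : fiberSum N G u = N := by
  classical
  unfold fiberSum
  have h1 : ∀ ω : Ω, ‖∑ z ∈ (range N).filter (fun z => G z = ω), ch N (u * z)‖ ^ 2 =
      ∑ z ∈ (range N).filter (fun z => G z = ω), ‖ch N (u * z)‖ ^ 2 := by
    intro ω
    set F := (range N).filter (fun z => G z = ω) with hF
    have hcard : ∀ a ∈ F, ∀ a' ∈ F, a = a' := by
      intro a ha a' ha'
      rw [hF, Finset.mem_filter] at ha ha'
      exact hG a ha.1 a' ha'.1 (ha.2.trans ha'.2.symm)
    rcases F.eq_empty_or_nonempty with h | ⟨z₀, hz₀⟩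
    · rw [h]; simp
    · have hF1 : F = {z₀} := Finset.eq_singleton_iff_unique_mem.2 ⟨hz₀, fun a ha => hcard a ha z₀ hz₀⟩
      rw [hF1, sum_singleton, sum_singleton]
  simp_rw [h1, norm_ch, one_pow]
  rw [Finset.sum_fiberwise (range N) G fun _ => (1 : ℝ), sum_const, card_range, nsmul_eq_mul, mul_one]

/-- **Periodic functions**: for `G = f ∘ (· mod a)` with `f` injective on the residues and
`0 < a ≤ N`, the fibres are the residue classes and
`S_G(u) = N² ∑_{k<a} P(u, k)`, `P` being Shor's outcome distribution `Shor1997.outcomeProb N a k u`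
(`norm_sq_amplitude_eq_outcomeProb`). [cite: Shor1997, §5 (probability of observing |c, x^k mod n>)] -/
theorem fiberSum_comp_mod {f : ℕ → Ω} {a : ℕ} (hf : ∀ k < a, ∀ k' < a, f k = f k' → k = k')
    (ha : 0 < a) (haN : a ≤ N) (u : ℕ) :
    fiberSum N (fun z => f (z % a)) u = (N : ℝ) ^ 2 * ∑ k ∈ range a, Shor1997.outcomeProb N a k u := by
  classical
  have hN : 0 < N := lt_of_lt_of_le ha haN
  have hN0 : (N : ℝ) ≠ 0 := by exact_mod_cast hN.ne'
  unfold fiberSum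
  set T : Ω → ℝ := fun ω => ‖∑ z ∈ (range N).filter (fun z => f (z % a) = ω), ch N (u * z)‖ ^ 2
    with hT
  -- only the images of the residues carry mass
  have hzero : ∀ ω ∈ (univ : Finset Ω), ω ∉ (range a).image f → T ω = 0 := by
    intro ω _ hω
    have hempty : (range N).filter (fun z => f (z % a) = ω) = ∅ := by
      rw [Finset.filter_eq_empty_iff]
      intro z _ hz
      exact hω (Finset.mem_image.2 ⟨z % a, mem_range.2 (Nat.mod_lt _ ha), hz⟩)
    simp [hT, hempty]
  rw [← Finset.sum_subset (Finset.subset_univ _) hzero,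
    Finset.sum_image fun k hk k' hk' h => hf k (mem_range.1 hk) k' (mem_range.1 hk') h, mul_sum]
  refine sum_congr rfl fun k hk => ?_
  have hka : k < a := mem_range.1 hk
  -- the fibre of `f k` is the residue class of `k`
  have hfilter : (range N).filter (fun z => f (z % a) = f k) = (range N).filter (fun z => z % a = k) := by
    refine Finset.filter_congr fun z _ => ⟨fun h => hf _ (Nat.mod_lt _ ha) k hka h, fun h => by rw [h]⟩
  rw [hT]
  dsimp only
  rw [hfilter, ← Shor1997.norm_sq_amplitude_eq_outcomeProb u hka (lt_of_lt_of_le hka haN), norm_mul, mul_pow,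
    norm_div, norm_one, Complex.norm_natCast]
  have hsum : ∑ z ∈ (range N).filter (fun z => z % a = k), ch N (u * z) =
      ∑ z ∈ (range N).filter (fun z => z % a = k),
        Complex.exp (2 * Real.pi * Complex.I * (z : ℂ) * (u : ℂ) / (N : ℂ)) := by
    refine sum_congr rfl fun z _ => ?_
    rw [ch]
    congr 1
    push_cast
    ring
  rw [hsum]
  have hN2 : (N : ℝ) ^ 2 * (1 / N) ^ 2 = 1 := by field_simp
  rw [← mul_assoc, hN2, one_mul]

end FiberSum

/-! ### The character sum over the controls factorises into the single tests -/

section Tests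

variable {J : Type*} [Fintype J] [DecidableEq J]

/-- The exponent `A(y) = ∑_j y_j 2^{e_j}` selected by the control string `y` (Kitaev's operator
`U^{[0,r]}`: control `j` applies the `2^{e_j}`-th power). [cite: Kitaev1995, §3 (Lemma 10)] -/
def expo (e : J → ℕ) (y : J → Bool) : ℕ := ∑ j, (y j).toNat * 2 ^ e j

/-- **The test product** `Φ(u) = ∏_j (χ_j(0) + χ_j(1) e^{2πi u 2^{e_j}/N})`: the amplitude sum over
the controls at the Fourier label `u`, factorised. [cite: Kitaev1995, §3 Lemma 8] -/
def testProd (N : ℕ) (e : J → ℕ) (χ : J → Bool → ℂ) (u : ℕ) : ℂ :=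
  ∏ j, (χ j false + χ j true * ch N (u * 2 ^ e j))

omit [Fintype J] in
/-- A character of a sum is the product of the characters. [folklore] -/
theorem ch_sum (N : ℕ) (s : Finset J) (m : J → ℤ) : ch N (∑ j ∈ s, m j) = ∏ j ∈ s, ch N (m j) := by
  classical
  induction s using Finset.induction_on with
  | empty => simp
  | insert j s hj ih => rw [sum_insert hj, prod_insert hj, ch_add, ih]

/-- **Factorisation** (Kitaev 1995, §3, Lemma 8 (3)):
`∑_y (∏_j χ_j(y_j)) e^{2πi u A(y)/N} = Φ(u)`. [cite: Kitaev1995, §3 Lemma 8] -/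
theorem sum_prod_mul_ch_expo (N : ℕ) (e : J → ℕ) (χ : J → Bool → ℂ) (u : ℕ) :
    ∑ y : J → Bool, (∏ j, χ j (y j)) * ch N (u * expo e y) = testProd N e χ u := by
  have hterm : ∀ y : J → Bool, (∏ j, χ j (y j)) * ch N (u * expo e y) =
      ∏ j, χ j (y j) * ch N (u * ((y j).toNat * 2 ^ e j)) := by
    intro y
    rw [prod_mul_distrib, ← ch_sum]
    congr 2
    unfold expo
    push_cast
    rw [mul_sum]
  simp_rw [hterm]
  rw [sum_pi_bool_prod fun j c => χ j c * ch N (u * (c.toNat * 2 ^ e j))]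
  unfold testProd
  refine prod_congr rfl fun j _ => ?_
  simp

/-- The one-bit amplitude factors of Kitaev's read-out `γ` with sine-test pattern `σ`:
`χ_j(0) = 1`, `χ_j(1) = (-1)^{γ_j} (-i)^{σ_j}` (`sPhase_mul_ySign`). [cite: Kitaev1995, §3 Remark 8] -/
def signChar (γ σ : J → Bool) (j : J) (c : Bool) : ℂ :=
  if c then (if γ j then (-1 : ℂ) else 1) * (if σ j then -I else 1) else 1

omit [Fintype J] [DecidableEq J] in
/-- `χ_j(0) = 1`. [folklore] -/
@[simp] theorem signChar_false (γ σ : J → Bool) (j : J) : signChar γ σ j false = 1 := rfl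

omit [DecidableEq J] in
/-- **The single tests** (Kitaev 1995, §3, Remark 8): with the read-out factors,
`|Φ(u)|² = 4^{#J} ∏_j P_j(γ_j | u)`, `P_j` the Hadamard-test probability `testWeight` at the angle
`2π u 2^{e_j}/N`. [cite: Kitaev1995, §3 Remark 8] -/
theorem norm_sq_testProd_signChar (N : ℕ) (e : J → ℕ) (γ σ : J → Bool) (u : ℕ) :
    ‖testProd N e (signChar γ σ) u‖ ^ 2 =
      4 ^ Fintype.card J * ∏ j, testWeight (γ j) (σ j) (2 * π * u * 2 ^ e j / N) := by
  rw [testProd, norm_prod, ← prod_pow]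
  have hfac : ∀ j, ‖signChar γ σ j false + signChar γ σ j true * ch N (u * 2 ^ e j)‖ ^ 2 =
      4 * testWeight (γ j) (σ j) (2 * π * u * 2 ^ e j / N) := by
    intro j
    have h := norm_sq_testAmplitude (γ j) (σ j) (2 * π * u * 2 ^ e j / N)
    rw [norm_div, div_pow, Complex.norm_ofNat] at h
    have hch : ch N (u * 2 ^ e j) = cexp ((2 * π * u * 2 ^ e j / N : ℝ) * I) := by
      rw [ch]; congr 1; push_cast; ring
    rw [signChar, signChar, if_pos rfl, if_neg Bool.false_ne_true, hch, testWeight]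
    linarith
  simp_rw [hfac]
  rw [prod_mul_distrib, prod_const, card_univ]

end Tests

/-! ### The read-out identity of the period-finding block -/

section ReadOut

variable {b : ℕ} {J Ω : Type*} [Fintype J] [DecidableEq J] [Fintype Ω] [DecidableEq Ω]

/-- The offset registers `{0,1}^b` and `[0, 2^b)` correspond by the little-endian value
(Batteries' `Nat.ofBits`). [folklore] -/
def bitsEquiv (b : ℕ) : (Fin b → Bool) ≃ Fin (2 ^ b) where
  toFun x := ⟨Nat.ofBits x, Nat.ofBits_lt_two_pow x⟩
  invFun t := fun i => (t : ℕ).testBit i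
  left_inv x := funext fun i => by simp
  right_inv t := Fin.ext (by simp [Nat.ofBits_testBit, Nat.mod_eq_of_lt t.2])

/-- Summing over the offset strings is summing over `[0, 2^b)`. [folklore] -/
theorem sum_ofBits_eq_sum_range {M : Type*} [AddCommMonoid M] (g : ℕ → M) :
    ∑ x : Fin b → Bool, g (Nat.ofBits x) = ∑ t ∈ range (2 ^ b), g t := by
  rw [← Fin.sum_univ_eq_sum_range]
  exact Fintype.sum_equiv (bitsEquiv b) _ _ fun x => rfl

/-- **The read-out identity of the period-finding block.** Offsets `x ∈ {0,1}^b` and controls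
`y ∈ {0,1}^J` in uniform superposition, a classical block writing `G((x + A(y)) mod 2^b)` into
the work register, then Hadamard read-out of all coins with one-bit factors `(-1)^{x·γ_T}` on
the offsets and `χ_j(y_j)` on the controls: summed over the offset read-out `γ_T` and the work
content `ω`, the squared fibre amplitudes are the MIXTURE over the Fourier label `u < 2^b`, with
weights the fibre sums `S_G(u)`, of the factorised test products `|Φ(u)|²`
(Plancherel on `{0,1}^b` for `γ_T`, then `sum_offset_fiber_norm_sq`, then
`sum_prod_mul_ch_expo`). [cite: Kitaev1995, §3 (Remark 8, Lemma 8) and §4] [cite: Shor1997, §5] -/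
theorem readout_identity (e : J → ℕ) (χ : J → Bool → ℂ) (G : ℕ → Ω) :
    ∑ γ : Fin b → Bool, ∑ ω : Ω, ‖∑ x : Fin b → Bool, ∑ y : J → Bool,
        (if G ((Nat.ofBits x + expo e y) % 2 ^ b) = ω then ySign x γ * ∏ j, χ j (y j) else 0)‖ ^ 2 =
      ∑ u ∈ range (2 ^ b), fiberSum (2 ^ b) G u * ‖testProd (2 ^ b) e χ u‖ ^ 2 := by
  classical
  have hN : 0 < 2 ^ b := Nat.two_pow_pos b
  -- pull the offset sign out of the fibre indicator
  have h1 : ∀ (γ : Fin b → Bool) (ω : Ω), (∑ x : Fin b → Bool, ∑ y : J → Bool,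
      (if G ((Nat.ofBits x + expo e y) % 2 ^ b) = ω then ySign x γ * ∏ j, χ j (y j) else 0)) =
      ∑ x : Fin b → Bool, ySign x γ * ∑ y : J → Bool,
        (if G ((Nat.ofBits x + expo e y) % 2 ^ b) = ω then ∏ j, χ j (y j) else 0) := by
    intro γ ω
    refine sum_congr rfl fun x _ => ?_
    rw [mul_sum]
    refine sum_congr rfl fun y _ => ?_
    split_ifs <;> simp
  simp_rw [h1]
  rw [sum_comm]
  simp_rw [cube_plancherel]
  rw [← mul_sum, sum_comm]
  rw [sum_ofBits_eq_sum_range (fun t => ∑ ω : Ω, ‖∑ y : J → Bool,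
    (if G ((t + expo e y) % 2 ^ b) = ω then ∏ j, χ j (y j) else 0)‖ ^ 2),
    sum_offset_fiber_norm_sq hN G (expo e) fun y => ∏ j, χ j (y j)]
  simp_rw [sum_prod_mul_ch_expo]
  rw [← mul_assoc]
  have h2 : (2 : ℝ) ^ b * (1 / (2 ^ b : ℕ)) = 1 := by
    push_cast
    field_simp
  rw [h2, one_mul]
  exact sum_congr rfl fun u _ => mul_comm _ _

end ReadOut

end PeriodFinding

end Literature.Computability.QuantumComplexity

end
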